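import Summits.CriticalPhenomena.SAWScalingLimit.Theses.SAWResidueField

/-!
# Birth skeleton (BC3) for the crux `SAWResidueField.ResidueEnergyVanishes`
(crux item stmt-CriticalPhenomena-5421, rank 2 of `route-CriticalPhenomena-SAWResidueField`;
skeleton registrar planner-skel-stmt-CriticalPhenomena-5421-0, 2026-08-17; tree path
`Summits/CriticalPhenomena/SAWScalingLimit/Cruxes/ResidueEnergyVanishes/Lines/birth.lean`.)

Crux (FIXED, by name): `ResidueEnergyVanishes` — for every Dobrushin domain, admissible hexagonal
discretisation family `Λ_δ`, boundary roots `a_δ → a` and residue potential `r_δ` of the critical SAW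
parafermion `F_δ` (the face-pole field `P_δ = Σ_(full x) r_δ(x)·HexKernel.witness x` with
`⟨F_δ − P_δ, witness x⟩ = 0` for every full hexagon `x`), on every compact `K ⊂ Ω` and for every `ε > 0`,
eventually `Σ_(e ∈ K) ‖P_δ(e)‖² ≤ ε Σ_(e ∈ K) ‖F_δ(e)‖²`.

## The line: POINTWISE LOCALISATION of the residue potential (4 registered stubs)

Two facts about the crux drive the cut. (i) The residue equations are a DIRICHLET PROBLEM on the triangular
lattice of hexagon centres: `⟨witness x, witness x⟩ = 6/9` and `⟨witness y, witness x⟩ = val (k+3)·conj (val k) = −1/9`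
for the two hexagons sharing `edge x k = edge y (k+3)` (central symmetry), so `pair (P_δ) x = (1/9)(6 r(x) − Σ_(y ∼ x, full) r(y))`
and the hypothesis reads `−(1/9) Δ_𝕋 r_δ = curl F_δ := pair F_δ` on full hexagons, `r_δ = 0` off them; the pole field on
an interior edge is a discrete gradient, `‖P_δ(e)‖ = (1/3)‖r_δ(x) − r_δ(y)‖`. (ii) The crux quantifies over ALL compact `K`,
thin ones included (a segment carries a whole row of mid-edges for a sequence `δ → 0`), so any proof must deliver a
POINTWISE bound `‖P_δ(e)‖ ≤ √ε ‖F_δ(e)‖` on `K`; energy (ℓ²) estimates on fat sets lose the volume factor `δ⁻²` and cannot.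
Hence a sup-norm line:

* S1 `stub_interiorEstimate` (PROVABLE NOW, M/L; deterministic discrete potential theory): `InteriorEstimate` — the
  interior gradient estimate for the lattice Poisson equation: if all vertices within `R + 4` of `mid e` are in `Λ`,
  `‖r‖ ≤ M` and `‖curl G‖ ≤ Q` on the hexagon centres within `R + 2` of `mid e`, and `r` is a residue potential of `G`,
  then `‖pole r e‖ ≤ C (M/R + R Q)` (`r = h + u` on the ball: harmonic `h`, `|∇h| ≤ C M/R`, Lawler–Limic Thm 6.3.8-type
  difference estimate on 𝕋; Poisson part `|∇u| ≤ Q Σ_(|y| ≤ R) |∇G_B(·,y)| ≤ C R Q`).  The `1/R` GAIN is the content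
  (the trivial bound is `(2/3) M`).  Stated for ARBITRARY `Λ, G, r` — no SAW input.
* S2 `stub_curlSmall` (OPEN, the HEART — conjecture-grade): `CurlSmall` — in the bulk the face circulation is `o(δ)`
  in sup norm relative to the local size of the observable: for `K` compact with `cthickening ρ K ⊂ Ω` and `η > 0`,
  eventually every hexagon centre `δ·y ∈ K` has `‖curl F_δ (y)‖ ≤ η δ ‖F_δ(e')‖` for SOME mid-edge `e'` of `Λ_δ` in
  `cthickening ρ K` (max-normalisation; no residue potential appears).  Continuum reading: with `F ≈ A + B ζ^j` on the
  three edge classes the vertex relation gives `∂̄A = ∂B` at order `δ`, the face circulation is `δ·L(A, B) + O(δ²)` for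
  an INDEPENDENT first-order combination `L` — `curl = o(δ)·F` is exactly the missing half of Cauchy–Riemann in the
  limit (DCS 2012 §4 "we expect that in the limit the curl vanishes"); predicted `O(δ²)·F`.
* S3 `stub_potentialSmall` (OPEN, M/L given S2-type input at all scales; the LOCALISATION statement): `PotentialSmall` —
  the residue potential itself is `o(δ⁻¹)` in sup norm on compacts relative to the same local scale:
  `‖r_δ(y)‖ ≤ η δ⁻¹ ‖F_δ(e')‖`.  `r_δ = 9 Σ_z G_Λ(y, z) curl F_δ(z)` is NON-LOCAL: bulk sources give `o(δ)·F·E[exit time]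
  = o(δ⁻¹) F`; the boundary layer (curl `≍ F`, Green function `≍ δ`, `δ⁻¹` sites) gives `O(1)·F_∂`; the root `a_δ`
  (where `F ≍ k^{-5/4}` at lattice distance `k`, bulk `F ≍ δ^{5/4}`) gives `Σ_k k·(δk)·k⁻²·k^{-5/4} = O(δ)` if the
  circulation is second-order small at every scale near the root — versus the allowance `δ⁻¹·δ^{5/4} = δ^{1/4}`.
  This is the far-field / boundary-decoupling half of the crux, absent from S2.
* S4 `stub_bulkHarnack` (OPEN, M/L; non-degeneracy): `BulkHarnack` — pointwise comparability of `|F_δ|` in the bulk: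
  `‖F_δ(e')‖ ≤ C_K ‖F_δ(e)‖` for `e` a mid-edge over `K` and `e'` over `cthickening ρ K`, eventually.  The conjectured
  limit `c (φ'/φ'(b))^{5/8}` has no zeros, but an asymptotic zero of `A + B ζ^j` on one edge class (staggered part
  `B ≢ 0`) would break it — S4 is where "the limit does not depend on the orientation of the edge" is load-bearing.
  Forced by (ii): the crux for thin `K` IS a pointwise statement, and pointwise smallness of `P_δ` needs `F_δ` not to
  (nearly) vanish where `P_δ` does not.

Composition `ResidueEnergyVanishes_of` (kernel-checked real-variable glue, no `sorry`): given `K`, `ε`, take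
`cthickening ρ₀ K ⊂ Ω` (`IsCompact.exists_cthickening_subset_open`), `ρ = ρ₀/5`; S4 on `(K, 4ρ)` gives `C_H`; put
`A = C·C_H·(1/ρ + ρ)`, `η = √ε / A`; S2, S3 on `(cthickening (3ρ) K, ρ)` with this `η`; exhaustion on `cthickening (5ρ) K`
makes every vertex within `R + 4 = ρ/δ + 4` lattice units of a mid-edge `e` over `K` belong to `Λ_δ` once `δ ≤ ρ`;
S1 at `e` with `R = ρ/δ`, `M = η δ⁻¹ C_H ‖F_δ(e)‖`, `Q = η δ C_H ‖F_δ(e)‖` gives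
`‖P_δ(e)‖ ≤ C (M δ/ρ + (ρ/δ) Q) = A η ‖F_δ(e)‖ = √ε ‖F_δ(e)‖`; square and sum over the finite set of mid-edges over `K`
(`hexDomainMidEdges` is finite).  Dimensional check: with the PREDICTED `curl = O(δ²) F` one gets `r = O(1) F`,
`P = O(δ) F`, share `δ²` — the route's numerical signature.

Vocabulary: `obs`, `fullHex`, `pole`, `curl`, `region`, `IsResidue`, `Admissible`, `Exhausts`, `RootTendsto` below
are VERBATIM abbreviations of the crux's `let`s and hypothesis blocks (the final theorem converts by `dsimp`/defeq).

Disproof used: none exists (`ledger crux ls stmt-CriticalPhenomena-5421`: no `Disproof.lean`, no prior line, 2026-08-17).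
`ledger negatives --problem CriticalPhenomena`: the refuted neighbours are HexObservableLimit (stmt-5420, corridor witness
relocating the ROOT conformally) and the all-δ tightness 0772 — neither shape occurs here: every stub is a RATIO statement
localised on compacts of `Ω`, eventual in `δ`, with no conformal map and no normalisation at a boundary point.

BC3 AUDIT (registrar, 2026-08-17, `lean check --json` on this file): rc 0, errors [], sorries 4 = the four `stub_*`
declarations (`stub_interiorEstimate`, `stub_curlSmall`, `stub_potentialSmall`, `stub_bulkHarnack`, the only
`declaration uses sorry` warnings), zero elsewhere; `residueEnergy_of_pointwise` (the real-variable glue) closed and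
sorry-free; `ResidueEnergyVanishes_of` = proof.conditional of the route decl
`Summit.CriticalPhenomena.SAWScalingLimit.Theses.SAWResidueField.ResidueEnergyVanishes` (BY NAME) under exactly the four
`__Registered.stub_*` hypotheses.  BC3 PROBES (registrar folder `bc/probe_<Def>.lean`, Def ∈ {InteriorEstimate, CurlSmall,
PotentialSmall, BulkHarnack}; vocabulary + statement defs copied verbatim WITHOUT the stubs so that `exact?` cannot use the
sorried theorems; `set_option maxHeartbeats 400000` per example): for each Def against BOTH `ResidueEnergyVanishes` and
`_root_.SAWScalingLimit`, the combined `first | exact? | simpa [Def] | (unfold Def; simpa) | aesop`, the payload form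
`first | exact? | simpa | aesop`, and the five alternatives one by one — 56/56 examples FAIL (`exact?` "could not close the
goal", `simpa`/`simpa [Def]`/`unfold; simpa` "Tactic `assumption` failed" with the implication as residual goal, `aesop`
"failed to prove the goal after exhaustive search", combined forms "unsolved goals").  No stub is cheaply the crux or the
summit.  Details and the line card: `Lines/birth.md`.
-/

noncomputable section

namespace Summit.CriticalPhenomena.SAWScalingLimit.Cruxes.ResidueEnergyVanishes.Birth

open scoped BigOperators Topology
open Filter Set
open Literature.Probability.LatticeModels
open Literature.Probability.RandomPlanarGeometry Literature.Probability.RandomPlanarGeometry.SAW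
open Literature.Barriers.CriticalPhenomena Literature.Barriers.CriticalPhenomena.HexKernel

set_option linter.unusedVariables false

/-! ## 1. Vocabulary — the crux's `let`s and hypothesis blocks, named -/

/-- The critical SAW parafermion of the family at mesh `δ` (the crux's `F δ`). -/
def obs (Λ : ℝ → Finset HexVertex) (a : ℝ → Sym2 HexVertex) (δ : ℝ) (z : Sym2 HexVertex) : ℂ :=
  hexParafermionicObservable (Λ δ) (a δ) hexCriticalFugacity (5 / 8) z

/-- The full hexagons of a vertex set (the crux's `fullHex`). -/
def fullHex (Λ : Finset HexVertex) : Set (Site 2) := {x | hexagonFaces x ⊆ Λ}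

/-- The face-pole field of a residue potential `r` (the crux's `pole`). -/
def pole (Λ : Finset HexVertex) (r : Site 2 → ℂ) (e : Sym2 HexVertex) : ℂ :=
  ∑ᶠ x ∈ fullHex Λ, r x * witness x e

/-- The face circulation `⟨G, witness x⟩` around the hexagon `x` (the crux's `pair`). -/
def curl (G : Sym2 HexVertex → ℂ) (x : Site 2) : ℂ :=
  ∑ j : Fin 6, G (edge x j) * (starRingEnd ℂ) (val j)

/-- The mid-edges of the domain whose scaled midpoint lies in `K` (the crux's `region`). -/
def region (Λ : Finset HexVertex) (δ : ℝ) (K : Set ℂ) : Set (Sym2 HexVertex) :=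
  {e | e ∈ hexDomainMidEdges Λ ∧ (δ : ℂ) * hexMidpoint e ∈ K}

/-- `r` is a residue potential of `G` on `Λ` (the crux's residue hypothesis at one mesh). -/
def IsResidue (Λ : Finset HexVertex) (G : Sym2 HexVertex → ℂ) (r : Site 2 → ℂ) : Prop :=
  ∀ x ∈ fullHex Λ, curl (fun e => G e - pole Λ r e) x = 0

/-- Admissibility block of the crux (simply connected, root on the boundary, connected, inside `Ω`). -/
def Admissible (D : DobrushinDomain) (Λ : ℝ → Finset HexVertex) (a : ℝ → Sym2 HexVertex) : Prop :=
  ∀ᶠ δ : ℝ in nhdsWithin 0 (Set.Ioi 0), hexDomainSimplyConnected (Λ δ) ∧ a δ ∈ hexDomainBoundary (Λ δ) ∧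
    (hexGraph.induce ((Λ δ : Finset HexVertex) : Set HexVertex)).Preconnected ∧
    (∀ v ∈ Λ δ, (δ : ℂ) * hexCenter v ∈ D.carrier)

/-- Exhaustion block of the crux. -/
def Exhausts (D : DobrushinDomain) (Λ : ℝ → Finset HexVertex) : Prop :=
  ∀ K : Set ℂ, IsCompact K → K ⊆ D.carrier → ∀ᶠ δ : ℝ in nhdsWithin 0 (Set.Ioi 0),
    ∀ v : HexVertex, (δ : ℂ) * hexCenter v ∈ K → v ∈ Λ δ

/-- Root-convergence block of the crux. -/
def RootTendsto (D : DobrushinDomain) (a : ℝ → Sym2 HexVertex) : Prop :=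
  Filter.Tendsto (fun δ : ℝ => (δ : ℂ) * hexMidpoint (a δ)) (nhdsWithin 0 (Set.Ioi 0)) (nhds (D.pt 0))

/-! ## 2. Statements of the line -/

/-- **(S1) Interior estimate** for residue potentials (deterministic; arbitrary `Λ`, `G`, `r`): a universal `C`
such that for every mid-edge `e` and radius `R ≥ 1` (lattice units), if every vertex within `R + 4` of `mid e`
lies in `Λ`, `‖r‖ ≤ M` and `‖curl G‖ ≤ Q` on the hexagon centres within `R + 2` of `mid e`, and `r` is a residue
potential of `G`, then `‖pole r e‖ ≤ C (M / R + R Q)`. -/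
def InteriorEstimate : Prop :=
  ∃ C : ℝ, 0 < C ∧ ∀ (Λ : Finset HexVertex) (G : Sym2 HexVertex → ℂ) (r : Site 2 → ℂ)
    (e : Sym2 HexVertex) (R M Q : ℝ), 1 ≤ R →
    (∀ v : HexVertex, ‖hexCenter v - hexMidpoint e‖ ≤ R + 4 → v ∈ Λ) →
    (∀ y : Site 2, ‖triEmbed y - hexMidpoint e‖ ≤ R + 2 → ‖r y‖ ≤ M ∧ ‖curl G y‖ ≤ Q) →
    IsResidue Λ G r →
    ‖pole Λ r e‖ ≤ C * (M / R + R * Q)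

/-- **(S2) Curl smallness** (sup norm, bulk): the face circulation of the critical parafermion is `o(δ)` relative
to the local size of the observable on compacts. -/
def CurlSmall : Prop :=
  ∀ (D : DobrushinDomain) (Λ : ℝ → Finset HexVertex) (a : ℝ → Sym2 HexVertex),
    Admissible D Λ a → Exhausts D Λ → RootTendsto D a →
    ∀ (K : Set ℂ) (ρ : ℝ), IsCompact K → 0 < ρ → Metric.cthickening ρ K ⊆ D.carrier →
    ∀ η : ℝ, 0 < η → ∀ᶠ δ : ℝ in nhdsWithin 0 (Set.Ioi 0), ∀ y : Site 2, (δ : ℂ) * triEmbed y ∈ K →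
      ∃ e' ∈ region (Λ δ) δ (Metric.cthickening ρ K),
        ‖curl (obs Λ a δ) y‖ ≤ η * δ * ‖obs Λ a δ e'‖

/-- **(S3) Potential smallness** (sup norm, bulk; localisation of the residue potential): a residue potential of
the critical parafermion is `o(δ⁻¹)` relative to the local size of the observable on compacts. -/
def PotentialSmall : Prop :=
  ∀ (D : DobrushinDomain) (Λ : ℝ → Finset HexVertex) (a : ℝ → Sym2 HexVertex) (r : ℝ → Site 2 → ℂ),
    Admissible D Λ a → Exhausts D Λ → RootTendsto D a →
    (∀ᶠ δ : ℝ in nhdsWithin 0 (Set.Ioi 0), IsResidue (Λ δ) (obs Λ a δ) (r δ)) →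
    ∀ (K : Set ℂ) (ρ : ℝ), IsCompact K → 0 < ρ → Metric.cthickening ρ K ⊆ D.carrier →
    ∀ η : ℝ, 0 < η → ∀ᶠ δ : ℝ in nhdsWithin 0 (Set.Ioi 0), ∀ y : Site 2, (δ : ℂ) * triEmbed y ∈ K →
      ∃ e' ∈ region (Λ δ) δ (Metric.cthickening ρ K),
        ‖r δ y‖ ≤ η * δ⁻¹ * ‖obs Λ a δ e'‖

/-- **(S4) Bulk Harnack comparability** of `|F_δ|`: on compacts the observable at any mid-edge over `K` dominates,
up to a constant, its values over a `ρ`-thickening of `K`. -/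
def BulkHarnack : Prop :=
  ∀ (D : DobrushinDomain) (Λ : ℝ → Finset HexVertex) (a : ℝ → Sym2 HexVertex),
    Admissible D Λ a → Exhausts D Λ → RootTendsto D a →
    ∀ (K : Set ℂ) (ρ : ℝ), IsCompact K → 0 < ρ → Metric.cthickening ρ K ⊆ D.carrier →
    ∃ C : ℝ, 0 < C ∧ ∀ᶠ δ : ℝ in nhdsWithin 0 (Set.Ioi 0), ∀ e ∈ region (Λ δ) δ K,
      ∀ e' ∈ region (Λ δ) δ (Metric.cthickening ρ K), ‖obs Λ a δ e'‖ ≤ C * ‖obs Λ a δ e‖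

/-! ## 3. Registered stubs (`sorry` only here) -/

/-- **S1 `stub_interiorEstimate`** — `InteriorEstimate` (PROVABLE NOW, M/L).  The residue equations on the full
hexagons are `(1/9)(6 r(x) − Σ_(y ∼ x full) r(y)) = curl G (x)` (Gram matrix of the face poles: `6/9` diagonal,
`−1/9` for 𝕋-adjacent hexagons — `edge x k = edge y (k+3)`, `val (k+3) = −val k`), i.e. the Dirichlet problem for
`Δ_𝕋` on the triangular lattice of hexagon centres (`triEmbed`, mesh 1); on an edge shared by `x, y`,
`pole r e = val k · (r x − r y)`, `‖val k‖ = 1/3`.  Split `r = h + u` on the lattice ball of radius `R + 1` about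
`mid e`: `Δ_𝕋 h = 0` with `|h| ≤ M + 9 C₀ R² Q`, difference estimate `|h(x) − h(y)| ≤ C₁ max|h| / R`; `u` = Green
potential of `9·curl` with zero boundary values, `|u(x) − u(y)| ≤ 9 Q Σ_z |G_B(x,z) − G_B(y,z)| ≤ C₂ R Q`.  Tools:
discrete harmonic-function difference estimates (Lawler–Limic, *Random Walk: A Modern Introduction*, Thm 6.3.8,
Prop 6.4.x) transported to the triangular walk; none of it is in tree yet (size driver). -/
theorem stub_interiorEstimate : InteriorEstimate := by
  sorry

/-- **S2 `stub_curlSmall`** — `CurlSmall` (OPEN, conjecture-grade; the HEART of DCS 2012 Conjecture 2: the missing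
half of the discrete Cauchy–Riemann relations holds asymptotically in the bulk, in sup norm, at rate `o(δ)` —
predicted `O(δ²)`).  Known: the circulation is EXACTLY non-zero at finite size (barrier file audit: relative size
`0.5 %–2.3 %` in domains up to 54 vertices, decreasing with size); no bound in print.  Why it might fail: an
orientation-dependent limit (`B ≢ 0`) or a non-holomorphic `A` makes `curl ≍ δ·F`.  Cheapest falsifier: exact
enumeration / transfer matrices in hexagonal discs of 6–14 lattice units — the ratio `max_K |curl F_δ| / (δ max |F_δ|)`
must DECREASE with the size. -/
theorem stub_curlSmall : CurlSmall := by
  sorry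

/-- **S3 `stub_potentialSmall`** — `PotentialSmall` (OPEN; the localisation / far-field statement).  With the
Dirichlet Green function `G_Λ` of `Δ_𝕋` on the full hexagons, `r_δ(y) = 9 Σ_z G_Λ(y,z) curl F_δ(z)`; the three
source regions (bulk: S2-type smallness × exit time `δ⁻²`; boundary layer: `curl ≍ F`, `G_Λ ≍ δ`, `δ⁻¹` sites; the
root: `F ≍ k^{-5/4}`, `G_Λ ≲ δ k`) are each `≪ δ⁻¹ · F_bulk ≍ δ^{1/4}` PROVIDED the circulation is second-order
small at every scale down to the root (first-order smallness alone is borderline, `δ^{1/4}` vs `δ^{1/4}`).  Why it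
might fail: a boundary layer or root neighbourhood whose circulations add coherently (a macroscopic far field of
the residue potential inside `Ω`).  Uses hypothesis H (residue equations on ALL full hexagons) essentially — a
potential satisfying the equations only near `K` is free up to a large harmonic function. -/
theorem stub_potentialSmall : PotentialSmall := by
  sorry

/-- **S4 `stub_bulkHarnack`** — `BulkHarnack` (OPEN, M/L).  `|F_δ(e)| ≤ G_δ(a_δ, e)` (two-point function) with
heavy phase cancellation in the bulk (`F ≍ δ^{5/4}` against `G ≍ δ^{35/48}`), so this is NOT a two-point-function
Harnack inequality: it asserts that the parafermion has no asymptotic zeros in the bulk, on any edge class — implied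
by the conjectured orientation-free non-vanishing limit `(φ')^{5/8}`, strictly weaker than it, unproved.  Why it
might fail: a staggered component `B` with `|B(z₀)| = |A(z₀)|` at some bulk point.  Cheapest falsifier: the same
enumeration data as S2 — `min/max` of `|F_δ|` over the three edge classes on an interior window must stay bounded. -/
theorem stub_bulkHarnack : BulkHarnack := by
  sorry

/-! ### Name-keyed aliases of the four statements — the hypotheses of `ResidueEnergyVanishes_of`

The skeleton audit (`#h21_check_skeleton`) admits a hypothesis of the skeleton theorem only if its head constant is
a registered obligation or is NAMED like a declared stub; `__Registered.stub_X` is the statement of `stub_X` under that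
name (device of `Cruxes/AxiomsOfLimit/Lines/birth.lean`, `Cruxes/AsymptoticMorera/Lines/birth.lean`; the gate-reserved
`@[stub]` attribute is not written by a planner).  Each alias is `rfl`-equal to its statement. -/
namespace __Registered

/-- Alias of `InteriorEstimate` keyed by the registered stub name. -/
abbrev stub_interiorEstimate : Prop := InteriorEstimate
/-- Alias of `CurlSmall` keyed by the registered stub name. -/
abbrev stub_curlSmall : Prop := CurlSmall
/-- Alias of `PotentialSmall` keyed by the registered stub name. -/
abbrev stub_potentialSmall : Prop := PotentialSmall
/-- Alias of `BulkHarnack` keyed by the registered stub name. -/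
abbrev stub_bulkHarnack : Prop := BulkHarnack

end __Registered

/-! ### Consistency: each named statement IS its registered stub -/

theorem interiorEstimate_holds : __Registered.stub_interiorEstimate := stub_interiorEstimate
theorem curlSmall_holds : __Registered.stub_curlSmall := stub_curlSmall
theorem potentialSmall_holds : __Registered.stub_potentialSmall := stub_potentialSmall
theorem bulkHarnack_holds : __Registered.stub_bulkHarnack := stub_bulkHarnack

/-! ## 4. Glue lemmas (sorry-free) -/

/-- The mid-edges of a finite vertex set form a finite set (so the crux's `finsum`s are true sums). [folklore] -/
theorem hexDomainMidEdges_finite (Λ : Finset HexVertex) : (hexDomainMidEdges Λ).Finite := by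
  have hsub : hexDomainMidEdges Λ ⊆
      ⋃ v ∈ (↑Λ : Set HexVertex), (fun w => s(v, w)) '' (↑(HexGreen.nbrs v) : Set HexVertex) := by
    intro e he
    obtain ⟨he, v, hv, hvΛ⟩ := he
    induction e using Sym2.ind with
    | h x y =>
      simp only [Set.mem_iUnion, Set.mem_image, Finset.mem_coe, exists_prop]
      rw [SimpleGraph.mem_edgeSet] at he
      rcases Sym2.mem_iff.1 hv with rfl | rfl
      · exact ⟨v, hvΛ, y, (HexGreen.mem_nbrs_iff v y).2 he, rfl⟩
      · exact ⟨v, hvΛ, x, (HexGreen.mem_nbrs_iff v x).2 he.symm, Sym2.eq_swap⟩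
  exact Set.Finite.subset (Set.Finite.biUnion (Finset.finite_toSet Λ) fun v _ =>
    (Finset.finite_toSet _).image _) hsub

/-- The mid-edges over a set `K` form a finite set. [folklore] -/
theorem region_finite (Λ : Finset HexVertex) (δ : ℝ) (K : Set ℂ) : (region Λ δ K).Finite :=
  (hexDomainMidEdges_finite Λ).subset fun _ he => he.1

/-- Monotonicity of `finsum` over a finite set of mid-edges. [folklore] -/
theorem finsum_mem_mono {S : Set (Sym2 HexVertex)} (hS : S.Finite) {f g : Sym2 HexVertex → ℝ}
    (h : ∀ e ∈ S, f e ≤ g e) : ∑ᶠ e ∈ S, f e ≤ ∑ᶠ e ∈ S, g e := by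
  rw [finsum_mem_eq_finite_toFinset_sum f hS, finsum_mem_eq_finite_toFinset_sum g hS]
  exact Finset.sum_le_sum fun e he => h e (hS.mem_toFinset.1 he)

/-- Scaling a lattice displacement by the mesh: `dist (δ z) (δ w) ≤ δ t` when `‖z − w‖ ≤ t`. [folklore] -/
theorem dist_scaled_le {δ t : ℝ} (hδ : 0 ≤ δ) {z w : ℂ} (h : ‖z - w‖ ≤ t) :
    dist ((δ : ℂ) * z) ((δ : ℂ) * w) ≤ δ * t := by
  rw [dist_eq_norm, ← mul_sub, norm_mul, Complex.norm_real, Real.norm_of_nonneg hδ]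
  exact mul_le_mul_of_nonneg_left h hδ

/-! ## 5. The composition in the line's vocabulary (sorry-free) -/

/-- **Pointwise localisation ⇒ vanishing residue energy**, in the vocabulary of §1: from S1–S4, for every compact
`K ⊂ Ω` and `ε > 0`, eventually `Σ_(region) ‖pole‖² ≤ ε Σ_(region) ‖F‖²` — via the pointwise bound
`‖pole e‖ ≤ √ε ‖F e‖` on `region (Λ δ) δ K`. -/
theorem residueEnergy_of_pointwise (hE : InteriorEstimate) (hC : CurlSmall) (hP : PotentialSmall)
    (hH : BulkHarnack) (D : DobrushinDomain) (Λ : ℝ → Finset HexVertex) (a : ℝ → Sym2 HexVertex)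
    (r : ℝ → Site 2 → ℂ) (hAdm : Admissible D Λ a) (hExh : Exhausts D Λ) (hRoot : RootTendsto D a)
    (hRes : ∀ᶠ δ : ℝ in nhdsWithin 0 (Set.Ioi 0), IsResidue (Λ δ) (obs Λ a δ) (r δ))
    (K : Set ℂ) (hK : IsCompact K) (hKΩ : K ⊆ D.carrier) (ε : ℝ) (hε : 0 < ε) :
    ∀ᶠ δ : ℝ in nhdsWithin 0 (Set.Ioi 0),
      (∑ᶠ e ∈ region (Λ δ) δ K, ‖pole (Λ δ) (r δ) e‖ ^ 2) ≤
        ε * ∑ᶠ e ∈ region (Λ δ) δ K, ‖obs Λ a δ e‖ ^ 2 := by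
  -- constants of the line
  obtain ⟨C, hC0, hEst⟩ := hE
  obtain ⟨ρ₀, hρ₀, hρ₀Ω⟩ := hK.exists_cthickening_subset_open D.isOpen hKΩ
  set ρ : ℝ := ρ₀ / 5 with hρdef
  have hρ : 0 < ρ := by positivity
  have h5ρ : 5 * ρ = ρ₀ := by rw [hρdef]; ring
  -- the nested compacts `K ⊆ K₃ = cthickening (3ρ) K ⊆ cthickening (4ρ) K ⊆ cthickening (5ρ) K ⊆ Ω`
  have hK5 : Metric.cthickening (5 * ρ) K ⊆ D.carrier := by rw [h5ρ]; exact hρ₀Ω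
  have hK4 : Metric.cthickening (4 * ρ) K ⊆ D.carrier :=
    (Metric.cthickening_mono (by linarith) K).trans hK5
  have hK3c : IsCompact (Metric.cthickening (3 * ρ) K) := hK.cthickening
  have h43 : Metric.cthickening ρ (Metric.cthickening (3 * ρ) K) ⊆ Metric.cthickening (4 * ρ) K := by
    have h := Metric.cthickening_cthickening_subset hρ.le (by positivity : (0 : ℝ) ≤ 3 * ρ) K
    rwa [show ρ + 3 * ρ = 4 * ρ by ring] at h
  have hK3ρ : Metric.cthickening ρ (Metric.cthickening (3 * ρ) K) ⊆ D.carrier := h43.trans hK4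
  -- the Harnack constant on `(K, 4ρ)`
  obtain ⟨CH, hCH0, hHar⟩ := hH D Λ a hAdm hExh hRoot K (4 * ρ) hK (by positivity) hK4
  -- the smallness parameter `η = √ε / A`, `A = C · C_H · (1/ρ + ρ)`
  set A : ℝ := C * CH * (1 / ρ + ρ) with hAdef
  have hA : 0 < A := by positivity
  set η : ℝ := Real.sqrt ε / A with hηdef
  have hη : 0 < η := div_pos (Real.sqrt_pos.2 hε) hA
  have hAη : A * η = Real.sqrt ε := by rw [hηdef]; field_simp
  -- eventualities
  have hCurl := hC D Λ a hAdm hExh hRoot (Metric.cthickening (3 * ρ) K) ρ hK3c hρ hK3ρ η hη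
  have hPot := hP D Λ a r hAdm hExh hRoot hRes (Metric.cthickening (3 * ρ) K) ρ hK3c hρ hK3ρ η hη
  have hEx5 := hExh (Metric.cthickening (5 * ρ) K) hK.cthickening hK5
  have hδpos : ∀ᶠ δ : ℝ in nhdsWithin 0 (Set.Ioi 0), 0 < δ := eventually_mem_nhdsWithin
  have hδρ : ∀ᶠ δ : ℝ in nhdsWithin 0 (Set.Ioi 0), δ ≤ ρ :=
    mem_nhdsWithin_of_mem_nhds (Iic_mem_nhds hρ)
  filter_upwards [hHar, hCurl, hPot, hEx5, hRes, hδpos, hδρ] with δ hHarδ hCurlδ hPotδ hExδ hResδ hδ hδρ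
  -- the pointwise bound on `region (Λ δ) δ K`
  have hpt : ∀ e ∈ region (Λ δ) δ K, ‖pole (Λ δ) (r δ) e‖ ≤ Real.sqrt ε * ‖obs Λ a δ e‖ := by
    intro e he
    have heK : (δ : ℂ) * hexMidpoint e ∈ K := he.2
    set S : ℝ := CH * ‖obs Λ a δ e‖ with hSdef
    have hS : 0 ≤ S := by positivity
    have hR : 1 ≤ ρ / δ := by rw [le_div_iff₀ hδ]; linarith
    -- every vertex within `R + 4` of `mid e` is in `Λ δ` (exhaustion on `cthickening (5ρ) K`)
    have hfull : ∀ v : HexVertex, ‖hexCenter v - hexMidpoint e‖ ≤ ρ / δ + 4 → v ∈ Λ δ := by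
      intro v hv
      apply hExδ
      refine Metric.mem_cthickening_of_dist_le _ _ _ _ heK ?_
      calc dist ((δ : ℂ) * hexCenter v) ((δ : ℂ) * hexMidpoint e)
          ≤ δ * (ρ / δ + 4) := dist_scaled_le hδ.le hv
        _ = ρ + 4 * δ := by field_simp
        _ ≤ 5 * ρ := by linarith
    -- sup bounds for `r δ` and `curl (F δ)` on the hexagon centres within `R + 2` of `mid e`
    have hbounds : ∀ y : Site 2, ‖triEmbed y - hexMidpoint e‖ ≤ ρ / δ + 2 →
        ‖r δ y‖ ≤ η * δ⁻¹ * S ∧ ‖curl (obs Λ a δ) y‖ ≤ η * δ * S := by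
      intro y hy
      have hy3 : (δ : ℂ) * triEmbed y ∈ Metric.cthickening (3 * ρ) K := by
        refine Metric.mem_cthickening_of_dist_le _ _ _ _ heK ?_
        calc dist ((δ : ℂ) * triEmbed y) ((δ : ℂ) * hexMidpoint e)
            ≤ δ * (ρ / δ + 2) := dist_scaled_le hδ.le hy
          _ = ρ + 2 * δ := by field_simp
          _ ≤ 3 * ρ := by linarith
      constructor
      · obtain ⟨e', he', hle⟩ := hPotδ y hy3
        have hcmp : ‖obs Λ a δ e'‖ ≤ S := hHarδ e he e' ⟨he'.1, h43 he'.2⟩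
        calc ‖r δ y‖ ≤ η * δ⁻¹ * ‖obs Λ a δ e'‖ := hle
          _ ≤ η * δ⁻¹ * S := mul_le_mul_of_nonneg_left hcmp (by positivity)
      · obtain ⟨e', he', hle⟩ := hCurlδ y hy3
        have hcmp : ‖obs Λ a δ e'‖ ≤ S := hHarδ e he e' ⟨he'.1, h43 he'.2⟩
        calc ‖curl (obs Λ a δ) y‖ ≤ η * δ * ‖obs Λ a δ e'‖ := hle
          _ ≤ η * δ * S := mul_le_mul_of_nonneg_left hcmp (by positivity)
    -- the interior estimate at `e` with `R = ρ/δ`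
    have hmain := hEst (Λ δ) (obs Λ a δ) (r δ) e (ρ / δ) (η * δ⁻¹ * S) (η * δ * S) hR hfull hbounds hResδ
    calc ‖pole (Λ δ) (r δ) e‖ ≤ C * (η * δ⁻¹ * S / (ρ / δ) + ρ / δ * (η * δ * S)) := hmain
      _ = A * η * ‖obs Λ a δ e‖ := by
          rw [hAdef, hSdef]; field_simp
      _ = Real.sqrt ε * ‖obs Λ a δ e‖ := by rw [hAη]
  -- square and sum over the finite set of mid-edges over `K`
  have hfin : (region (Λ δ) δ K).Finite := region_finite _ _ _
  calc (∑ᶠ e ∈ region (Λ δ) δ K, ‖pole (Λ δ) (r δ) e‖ ^ 2)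
      ≤ ∑ᶠ e ∈ region (Λ δ) δ K, ε * ‖obs Λ a δ e‖ ^ 2 := by
        refine finsum_mem_mono hfin fun e he => ?_
        calc ‖pole (Λ δ) (r δ) e‖ ^ 2 ≤ (Real.sqrt ε * ‖obs Λ a δ e‖) ^ 2 :=
              pow_le_pow_left₀ (norm_nonneg _) (hpt e he) 2
          _ = ε * ‖obs Λ a δ e‖ ^ 2 := by rw [mul_pow, Real.sq_sqrt hε.le]
    _ = ε * ∑ᶠ e ∈ region (Λ δ) δ K, ‖obs Λ a δ e‖ ^ 2 := (mul_finsum_mem _ ε).symm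

/-! ## 6. The skeleton theorem: the four stubs imply the crux, BY NAME -/

/-- **`ResidueEnergyVanishes` from the line `birth`** (kernel-checked, no `sorry` of its own): hypotheses = the
four stubs under their registered names; conclusion = the route decl, by name.  The crux's `let`s are this file's
vocabulary definitionally (`dsimp` + defeq). -/
theorem ResidueEnergyVanishes_of (h1 : __Registered.stub_interiorEstimate) (h2 : __Registered.stub_curlSmall)
    (h3 : __Registered.stub_potentialSmall) (h4 : __Registered.stub_bulkHarnack) :
    Summit.CriticalPhenomena.SAWScalingLimit.Theses.SAWResidueField.ResidueEnergyVanishes := by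
  intro D Λ a r
  dsimp only
  intro hAdm hExh hRoot hRes K hK hKΩ ε hε
  exact residueEnergy_of_pointwise h1 h2 h3 h4 D Λ a r hAdm hExh hRoot hRes K hK hKΩ ε hε

/-- Wiring check (an `example`, so that `ResidueEnergyVanishes_of` stays the only theorem concluding the crux):
the registered stubs, with their stated types, feed the skeleton theorem — this term becomes the crux proof when
the four `sorry`s above are discharged. -/
example : Summit.CriticalPhenomena.SAWScalingLimit.Theses.SAWResidueField.ResidueEnergyVanishes :=
  ResidueEnergyVanishes_of stub_interiorEstimate stub_curlSmall stub_potentialSmall stub_bulkHarnack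

end Summit.CriticalPhenomena.SAWScalingLimit.Cruxes.ResidueEnergyVanishes.Birth

end
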